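import Summits.AtomisticToContinuum.BoseEinsteinCondensation.Theses.BECInsertionCorrector
import Summits.AtomisticToContinuum.BoseEinsteinCondensation.Theorems.BECInsertionCorrectorCorrectorClosureReductionToFactors
import Summits.AtomisticToContinuum.BoseEinsteinCondensation.Theorems.BECInsertionCorrectorCorrectorClosureGroundStateFrame
import Summits.AtomisticToContinuum.BoseEinsteinCondensation.Theorems.BECInsertionCorrectorCorrectorClosureTiltCorrector
import Summits.AtomisticToContinuum.BoseEinsteinCondensation.Theorems.BECInsertionCorrectorCorrectorClosureResponseDictionaryMollifier
import Summits.AtomisticToContinuum.BoseEinsteinCondensation.Theorems.CorrectorClosure.Negative.KacClosureHMinusOneSingleMode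
import Summits.AtomisticToContinuum.BoseEinsteinCondensation.Theorems.BECInsertionCorrectorCorrectorClosureRemovalEnergyBudget
import Literature.MathematicalPhysics.QuantumManyBody.WeightedCorrector
import Literature.MathematicalPhysics.QuantumManyBody.PeriodicGroundStateNondegenerate
import HarnessLib.Audit

/-!
# Line `zero-mode-removal-susceptibility` — skeleton v2 (lead c8, 2026-08-17; v1 by the crux-plan seat) for crux
`BECInsertionCorrector.CorrectorClosure`
(item stmt-AtomisticToContinuum-12058, route route-AtomisticToContinuum-BECInsertionCorrector;
crux-plan seat planner-cruxplan-stmt-AtomisticToContinuum-12058-zero-mode-removal-su-0, 2026-08-16;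
idea card `Cruxes/CorrectorClosure/Ideas/zero-mode-removal-susceptibility.md`, triage r2-1/2/3: pass ×3)

Crux (fixed, by name): `CorrectorClosure := StaticResponseBound → InsertionResidue`.

## v2 (lead c8, sixteenth lead, 2026-08-17T14:45Z): Stub B discharged by import; 3 sorries left, all item-sized

* Stub B `stub_removalEnergyBudget` is LANDED verbatim in this line's Theorems namespace
  (`Theorems/BECInsertionCorrectorCorrectorClosureRemovalEnergyBudget.lean`, p135833, lead a5 — proved from inside the
  sibling line `volume-homotopy-sum-rule-domination`, whose stub B has the same signature): the `sorry` is replaced by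
  that theorem; statement byte-identical.
* Open (sorries): R `stub_regularRemovalSusceptibility` (the heart; held by the lead; no device in tree or print — see
  the lead's census `Lines/zero-mode-removal-susceptibility-dead.md` if this line is closed), `stub_periodicBEC`
  (= `StaticResponseBound →` the body of LIVE item stmt-AtomisticToContinuum-8997 for bounded `v`; kernel-checked
  NECESSARY for the crux, p121285; dischargeable the day 8997 lands, by modus ponens), `stub_unboundedCase` (shared
  hard-core hole of every line of this crux). wave: none — both non-heart stubs are item-sized (torus BEC given K1;
  the hard-core Feynman–Kac frame), exactly as leads c3/c6/c7 found for the verbatim-identical stubs of their lines.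

## The line in one paragraph

By the landed reduction `correctorClosure_of_factors` (p122159, `Theorems/…ReductionToFactors.lean`) the
crux follows from three factors: torus BEC of near-minimisers given K1 (`stub_periodicBEC`, the body of
item stmt-AtomisticToContinuum-8997 under K1, SHARED with every line of this crux and kernel-checked
NECESSARY, p121285), the hard-core frame (`stub_unboundedCase`, shared), and the route-specific
REMOVAL-FIDELITY floor `c₂ ∫G² ≤ (∫Θ₀G)²` for the torus Feynman–Kac ground states `Θ₀` (`N` bodies) and
`Φ₀` (`N+1` bodies), `G(X) = ∫_cell Φ₀(x,X)dx ∝ a(φ₀)Φ₀` the zero-mode removal state. THIS LINE is the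
typed module for the third factor (card `zero-mode-removal-susceptibility`), in the tree's Kipnis–Varadhan
`H₋₁` vocabulary over the weight `Θ₀` (ground-state representation, `WeightedCorrector.lean`): with the
removal RATIO `g = G/Θ₀` (`= ĥ₀`, the `k = 0` member of the hole-amplitude family of card
`insertion-mode-gaussian-domination`) and its centring `g_c = g − ∫Θ₀G`,

* `‖G_⊥‖² = ∫ g_c² Θ₀² = ∫G² − (∫Θ₀G)²`                       (exact; `∫Θ₀² = 1`),
* `m₁(G_⊥) = m₁(G) = 𝓔_{Θ₀}(g,g) = 𝓔_{Θ₀}(g_c,g_c) ≤ μ_{N+1} ∫G²`   (`stub_removalEnergyBudget`: FIRST MOMENT,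
  exact by positivity — the `(N+1)`-body Euler–Lagrange equation of `Φ₀` integrated over the removed
  particle's cell, `∫_cell Δ_xΦ₀ = 0`, `∫G∫WΦ₀ ≥ 0`; then Davies' ground-state representation w.r.t. `Θ₀`),
* `m₋₁(G_⊥) = ‖g_c‖²₋₁ = hMinusOneSqW L Θ₀ g_c`, and the heart `stub_regularRemovalSusceptibility`:
  `μ_{N+1} · ‖g_c‖²₋₁ ≤ η ∫G²` with ONE `η < 1` uniform in `N` at small density (REGULAR — pole-removed —
  ZERO-MODE REMOVAL SUSCEPTIBILITY; Bogoliubov value of the ratio `μ‖g_c‖²₋₁/∫G² = O(√(ρa³)log(L/ξ)/N)`,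
  a factor `N/(√(ρa³) log L)` of room),
* SANDWICH (landed, `Negative.sq_integral_sq_le_of_hMinusOneSqW_le` = Kipnis–Varadhan's criterion):
  `(∫g_c²Θ₀²)² ≤ ‖g_c‖²₋₁ · 𝓔_{Θ₀}(g_c,g_c) ≤ (η∫G²/μ)·(μ∫G²)`, so `‖G_⊥‖² ≤ √η ∫G²` and
  `(∫Θ₀G)² ≥ (1 − √η) ∫G²` — the removal-fidelity factor with `c₂ = 1 − √η`.

The sandwich and the factor are PROVED below (`removalFidelity_of_moments`, sorry-free given the two
module stubs); `CorrectorClosure_of` is `correctorClosure_of_factors` applied to `stub_periodicBEC`, the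
module, and `stub_unboundedCase`. K1 is consumed in `stub_periodicBEC` (and nominally in
`stub_unboundedCase`); the removal module does not use K1 (declared on the card; triage r2: "harmless for
THIS factor").

Why the product form `μ·‖g_c‖²₋₁ ≤ η∫G²` (division-free, normalised by `∫G²`, `μ = μ_{N+1}` itself):
triage r2-2/r2-3 typing defect of the card (allowance `ηL³/(ρ(∫v).toReal)` is `0`-junk for `⊤`-valued
`v`) is moot here — the module is stated for the bounded branch, scaled by `μ_{N+1} = E₀(N+1) − E₀(N)`
(what the sandwich consumes, finite by `IsPeriodicGroundStateFK.energy_ne_top`), and relative to `∫G²`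
so that it yields the fidelity factor WITHOUT the BEC floor (the floor `∫G² ≥ c₁L³` lives in
`stub_periodicBEC` and is multiplied in by `residueFloor_of_factors'`). `η` is fixed ONCE per density
(`∃ η < 1` before `∀ᶠ N`; the weakest threshold the assembly needs, checklist (iv)).

## Stubs registered in v1 (4)

`stub_removalEnergyBudget` (M/L, provable now, worker), `stub_regularRemovalSusceptibility` (XL, the
line's heart, lead), `stub_periodicBEC` (XL, shared factor = item 8997 under K1, verbatim the v6.1
signature of line `residue-area-law`; to be discharged by the sibling lines
`volume-homotopy-sum-rule-domination` / `insertion-mode-gaussian-domination` or by item 8997 itself),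
`stub_unboundedCase` (XL, shared hard-core hole, verbatim). `CorrectorClosure_of` is sorry-free given
the stubs and concludes the crux BY NAME.

## Disproof.lean (gen 4 v10) and landed `Negative/*` — obligations

§1 (`not_correctorClosure_iff`: any proof must use K1) — K1 enters BY NAME in `stub_periodicBEC`
(the factor where it must do density-sector work) and `stub_unboundedCase`; §3/§7 (window; `δ` after
`N`) — the module works with EXACT FK ground states, near-minimisers only through the landed fixed-`N`
rigidity inside `correctorClosure_of_factors`; §4 (`E₀ < ⊤`) — `μ_{N+1}` is a difference of two
`toReal`s of finite energies (`energy_ne_top`); §5/§8 (`A ≤ f₀ ≤ 1`, no `c > 1`) — the module bounds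
`1 − F ≥ 0` from above, `c₂ = 1 − √η ≤ 1`; free gas: `G ∥ Θ₀`, `g_c = 0`, `‖0‖₋₁ = 0`, both stubs hold
with `B = 0`; §10 — every threshold is `∃ ρᵢ > 0`; §13 (d = 1 analogue false) — the dimension test sits
in `stub_periodicBEC` (torus BEC), the removal factor is `d`-insensitive by design (card item (e));
§16 — the sandwich IS `Negative/KacClosureHMinusOneSingleMode.sq_integral_sq_le_of_hMinusOneSqW_le`
(imported and used in the glue), and `‖g_c‖₋₁ < ⊤` is consistent with `hMinusOneSqW_eq_top` because
`g_c` is centred (`∫g_cΘ₀² = ∫Θ₀G − ∫Θ₀G·∫Θ₀² = 0`). No `-- Targets` theorem of Disproof v10 names a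
stub of this line; no landed Negative lemma concerns removal states.
-/

noncomputable section

open MeasureTheory Filter Matrix
open scoped ENNReal NNReal BigOperators ComplexConjugate

namespace Summit.AtomisticToContinuum.BoseEinsteinCondensation.Cruxes.CorrectorClosure.ZeroModeRemovalSusceptibility

open Literature.MathematicalPhysics.QuantumManyBody.BoseGas
open Summit.AtomisticToContinuum.BoseEinsteinCondensation.Theses.BECInsertionCorrector
open Summit.AtomisticToContinuum.BoseEinsteinCondensation.Theorems.CorrectorClosure.ResidueAreaLaw
  (correctorClosure_of_factors)
open Summit.AtomisticToContinuum.BoseEinsteinCondensation.Theorems.CorrectorClosure.Negative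
  (sq_integral_sq_le_of_hMinusOneSqW_le sideLength_succ_pos)
open Summit.AtomisticToContinuum.BoseEinsteinCondensation.Theorems.CorrectorClosure.HealingScaleKacInsertion.ResponseDictionary
  (integral_sq_eq_one_of_fk)

set_option linter.unusedVariables false

/-! ## Conventions of the signatures

As in `correctorClosure_of_factors` (the hFid slot this module fills): `Θ₀ : Config N → ℝ` and
`Φ₀ : Config (N+1) → ℝ` are continuous strictly positive torus Feynman–Kac ground states
(`IsPeriodicGroundStateFK v L ·`) in the box `L = sideLength ρ (N+1)` with `v^per` bounded; the removal
amplitude is bound as `∀ G, G = (fun X => ∫ x in cell L, Φ₀ (vecCons x X)) → …`; the removal RATIO is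
`fun X => G X / Θ₀ X` (`Θ₀ > 0`), its centring subtracts the constant `∫ X in cellN N L, Θ₀ X * G X`
(`= ⟨Θ₀, G⟩`, so that the centred ratio has `Θ₀²`-mean zero because `∫Θ₀² = 1`); the increment of the
ground-state energy is `μ = (E₀ v (N+1) L).toReal − (E₀ v N L).toReal` (both finite). Real Bochner
integrals on the cell; `ℝ≥0∞` only for `hMinusOneSqW` and in the conclusion of the factor. -/

/-! ## Stubs (the open / delegated lemmas of the line; `sorry` only here) -/

/-- **Stub B — the removal energy budget in ground-state representation (FIRST MOMENT; size M/L;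
LANDED p135833, lead a5 — discharged below by that theorem, v2).** In a box `L > 0` with bounded `v^per`, for continuous positive torus FK ground
states `Θ₀` (`N` bodies) and `Φ₀` (`N+1` bodies) and the removal amplitude `G = ∫_cell Φ₀(x,·)dx`, the
removal ratio `g = G/Θ₀` is a periodic test function (`C¹`, lattice periodic) and its `Θ₀`-Dirichlet
energy is at most the chemical potential times the removal mass:
`𝓔_{Θ₀}(g,g) = ∫|∇g|²Θ₀² ≤ (E₀(N+1) − E₀(N)) ∫ G²` — in operator words `⟨G,(H_N − E₀(N))G⟩ ≤ μ_{N+1}‖G‖²`: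
the normalised removal state `a₀Φ₀/‖a₀Φ₀‖` is an `N`-body trial state of energy `≤ E₀(N+1)`.
Proof route (all tools landed): (i) `Θ₀, Φ₀ ∈ C¹` (`stub_periodicGroundStateRegularity`, bounded `v^per`)
and read in `ℂ` they are periodic trial states attaining the finite ground-state energies
(`GeometricMeanCorrector.exists_trialState_of_fk`, `periodicEnergy_le_of_isPeriodicGroundStateFK`,
cf. `groundStateFrame`); `G ∈ C¹` by differentiation under the cell integral, lattice periodic
(`rl_removal_periodic`), hence `g = G/Θ₀` is a periodic test function; (ii) test the weak Euler–Lagrange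
equation of `Φ₀` for ALL periodic `C¹` tests (`tilt_el_all`, p125047) on `ζ = (G∘tail)/Φ₀`, i.e. pair
`H_{N+1}Φ₀ = E₀(N+1)Φ₀` with `u(x,X) = G(X)`: the `x`-gradient of `u` vanishes, Fubini over
`cell × cellN` (`tilt_setIntegral_cellN_succ_left`) turns `∫∇Φ₀·∇u` into `∫|∇G|²` and `∫uΦ₀` into `∫G²`,
and the pair sum splits `V_{N+1} = V_N∘tail + W` (`tilt_el_tail`, p125668) with `∫ G ∫_cell WΦ₀ ≥ 0`
(`G, W, Φ₀ ≥ 0` — positivity and repulsion: NO Born term, hard-core safe in principle), whence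
`∫|∇G|² + ∫V_N G² ≤ E₀(N+1)∫G²`; (iii) Davies' ground-state representation w.r.t. `Θ₀` (the `N`-body
E–L equation tested on `ζ = g²`): `∫|∇(gΘ₀)|² + ∫V_N g²Θ₀² = 𝓔_{Θ₀}(g,g) + E₀(N)∫g²Θ₀²`. Subtract.
Why plausibly true: it is an identity plus two dropped nonnegative terms; its FK/Laplace shadow
`e^{-tE₀(N+1)}(∫G²)² ≤ L³⟨G,e^{-tH_N}G⟩` is landed (`stub_removalLaplace`, p120495). Degenerate cases:
`v = 0` ⇒ `G` constant, `g` constant, `𝓔 = 0 ≤ 0`; `N = 0` ⇒ both sides `0`.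
Leans on: `tilt_el_all`, `tilt_el_tail`, `tilt_setIntegral_cellN_succ_left`, `stub_periodicGroundStateRegularity`,
`exists_trialState_of_fk`, `periodicEnergy_le_of_isPeriodicGroundStateFK`, `rl_removal_periodic`,
`dirichletFormW`, `IsPeriodicTest` (all in tree). [cite: Davies1989, §4.2 Thm 4.2.1 (ground-state transform)]
[cite: ReedSimonIV1978, §XIII.1 (Rayleigh–Ritz)] -/
theorem stub_removalEnergyBudget (v : ℝ → ℝ≥0∞) (hv : IsRepulsiveFiniteRange v) (N : ℕ) (L : ℝ)
    (hL : 0 < L) (hb : ∃ C : ℝ≥0, ∀ x, periodizedPotential v L x ≤ C)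
    (Θ₀ : Config N → ℝ) (hΘ : IsPeriodicGroundStateFK v L Θ₀) (hΘc : Continuous Θ₀) (hΘp : ∀ X, 0 < Θ₀ X)
    (Φ₀ : Config (N + 1) → ℝ) (hΦ : IsPeriodicGroundStateFK v L Φ₀) (hΦc : Continuous Φ₀)
    (hΦp : ∀ X, 0 < Φ₀ X)
    (G : Config N → ℝ) (hG : G = fun X => ∫ x in cell L, Φ₀ (vecCons x X)) :
    IsPeriodicTest L (fun X => G X / Θ₀ X) ∧
      dirichletFormW L Θ₀ (fun X => G X / Θ₀ X) (fun X => G X / Θ₀ X) ≤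
        ((periodicGroundStateEnergy v (N + 1) L).toReal - (periodicGroundStateEnergy v N L).toReal) *
          ∫ X in cellN N L, G X ^ 2 :=
  -- LANDED (p135833): `Theorems/BECInsertionCorrectorCorrectorClosureRemovalEnergyBudget.lean`
  Summit.AtomisticToContinuum.BoseEinsteinCondensation.Theorems.CorrectorClosure.ZeroModeRemovalSusceptibility.stub_removalEnergyBudget
    v hv N L hL hb Θ₀ hΘ hΘc hΘp Φ₀ hΦ hΦc hΦp G hG

/-- **Stub R — REGULAR ZERO-MODE REMOVAL SUSCEPTIBILITY (the heart of the line; size XL, OPEN, held by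
the lead; K1 NOT used — declared).** For every BOUNDED repulsive finite-range `v` there is `ρ₃ > 0` such
that for `0 < ρ < ρ₃` there is ONE `η ∈ [0,1)` with, for all large `N` (box `L = sideLength ρ (N+1)`,
`v^per` bounded there) and all continuous positive torus FK ground states `Θ₀` (`N` bodies), `Φ₀`
(`N+1` bodies), `G = ∫_cell Φ₀(x,·)dx`: the centred removal ratio `g_c = G/Θ₀ − ⟨Θ₀,G⟩` has FINITE
Kipnis–Varadhan `H₋₁` norm for the weight `Θ₀` and
`μ_{N+1} · ‖g_c‖²₋₁ ≤ η · ∫G²`, `μ_{N+1} = E₀(N+1) − E₀(N)`, written division-free as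
`∃ B ≥ 0, hMinusOneSqW L Θ₀ g_c ≤ B ∧ μ_{N+1}·B ≤ η∫G²`. Dictionary: `‖g_c‖²₋₁ = m₋₁(G_⊥) =
⟨G_⊥,(H_N − E₀(N))⁻¹G_⊥⟩ = sup_{Ξ ⊥ Θ₀} |⟨Ξ,G⟩|²/⟨Ξ,(H_N−E₀)Ξ⟩` (ground-state representation
`Ξ = φΘ₀`, `⟨Ξ,(H−E₀)Ξ⟩ = 𝓔_{Θ₀}(φ,φ)`, Kipnis–Landim's variational formula = the definition of
`hMinusOneSqW`), `G_⊥ = G − ⟨Θ₀,G⟩Θ₀` the part of the zero-mode removal state `a₀Φ₀` orthogonal to the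
`N`-body ground state. In words: NO `O(N)` PILE-UP OF REMOVAL-STATE SPECTRAL WEIGHT BELOW ENERGY `μ` at
total momentum `0` — the `k = 0`, pole-removed endpoint of the one-particle-removal susceptibility
`b₋(N+1,k)` (sibling item stmt-AtomisticToContinuum-12620 asks `b± ≤ C/k²` for `k ≠ 0` only), in the
same `hMinusOneSqW` currency as the landed `StaticResponseToHMinusOne` (item 12060) and as
`stub_responseDictionary` of line `healing-scale-kac-insertion`. Energy-curvature reading (Kato, the
degenerate direction `Θ₀` removed): `inf spec{[(H_N−E₀(N))|_{Θ₀^⊥}] ⊕ [H_{N+1}−E₀(N+1)] +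
t(Q_{Θ₀}a(φ₀) + h.c.)} ≥ −(N+1)L⁻³ B t²`.
Why plausibly true: number-conserving Bogoliubov theory gives `(a₀Φ₀)_⊥ ≈ −(2√n₀)⁻¹(N̂_ex − ⟨N̂_ex⟩)Θ₀`,
the soft pair `(k,−k)` carries weight `∼ u_k²v_k²/N` at energy `2e_k`, and
`μ‖g_c‖²₋₁/∫G² = O(√(ρa³) log(L/ξ)/N) → 0` — a factor `N/(√(ρa³)log L)` BELOW the allowance `η < 1`
(card; lead a4 PICKED.md §2; triage r2-2 independent estimate agree). Finiteness of `‖g_c‖₋₁` at fixed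
`N, L` is the weighted Poincaré inequality for `Θ₀²` (continuous, bounded above and below on the compact
torus) — the finite-volume gap, used only qualitatively (`∃ B`). The discarded GAP route (`m₋₁ ≤ ‖G_⊥‖²/Δ`)
would need `Δ > μ ≈ 8πρa`, false at scale `L` (`Δ ≈ 2c_s·2π/L`), which is why the susceptibility and not
the gap is the typed object. Why it might fail: a two-branch (cat) ground state makes
`m₋₁(G_⊥) ∼ N²/Δ_cat` (barrier `SymmetryBreakingWithoutCondensate`, conceded on the card; the same
zero-momentum susceptibility controls sibling item 12616); beyond one loop nothing in print bounds the
`k = 0` removal susceptibility uniformly in `N` (Gavoret–Nozières / Nepomnyashchii logarithms live in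
this propagator — absorbed by the room, but an `N¹` excess of weight below `μ` is not).
Degenerate cases: `v = 0` ⇒ `G ∥ Θ₀`, `g_c = 0`, `‖0‖₋₁ = 0`, take `B = 0`; `μ_{N+1} = 0` ⇒ any finite
`B` works (`η ≥ 0`). Transfer `C⁺` of the card, typed: `C⁺ = this stub`; `C⁺ ∧ Stub B ⇒ RemovalFidelity`
is PROVED below (`removalFidelity_of_moments`).
Leans on: `hMinusOneSqW`, `dirichletFormW` (WeightedCorrector); nothing in the tree supplies it.
[cite: KipnisLandim1999, App. 1 §6 (6.1)] [cite: GuentherEtAl2021, (10)] [cite: PitaevskiiStringari1991, (9)] -/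
theorem stub_regularRemovalSusceptibility (v : ℝ → ℝ≥0∞) (hv : IsRepulsiveFiniteRange v)
    (hbdd : ∃ C : ℝ≥0, ∀ r, v r ≤ C) :
    ∃ ρ₃ : ℝ, 0 < ρ₃ ∧ ∀ ρ : ℝ, 0 < ρ → ρ < ρ₃ → ∃ η : ℝ, 0 ≤ η ∧ η < 1 ∧
      ∀ᶠ N : ℕ in atTop, ∀ (L : ℝ), L = sideLength ρ (N + 1) →
        (∃ C : ℝ≥0, ∀ x, periodizedPotential v L x ≤ C) →
        ∀ (Θ₀ : Config N → ℝ), IsPeriodicGroundStateFK v L Θ₀ → Continuous Θ₀ → (∀ X, 0 < Θ₀ X) →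
        ∀ (Φ₀ : Config (N + 1) → ℝ), IsPeriodicGroundStateFK v L Φ₀ → Continuous Φ₀ →
          (∀ X, 0 < Φ₀ X) →
        ∀ (G : Config N → ℝ), (G = fun X => ∫ x in cell L, Φ₀ (vecCons x X)) →
          ∃ B : ℝ, 0 ≤ B ∧
            hMinusOneSqW L Θ₀ (fun X => G X / Θ₀ X - ∫ Y in cellN N L, Θ₀ Y * G Y) ≤
              ENNReal.ofReal B ∧
            ((periodicGroundStateEnergy v (N + 1) L).toReal
                - (periodicGroundStateEnergy v N L).toReal) * B ≤
              η * ∫ X in cellN N L, G X ^ 2 := by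
  sorry

/-- **Stub — torus BEC given K1, bounded potentials (shared factor 1; size XL, OPEN; K1 consumed HERE,
by name; typed VERBATIM as `ResidueAreaLaw.stub_periodicBEC` of skeleton v6.1 = the `hBEC` slot of
`correctorClosure_of_factors`).** Given `StaticResponseBound`, for every BOUNDED repulsive finite-range
`v`: the body of the summit-wide statement `PeriodicBEC` (LIVE item stmt-AtomisticToContinuum-8997;
0826 is closed `moot` with the identical signature) — there is `ρ₀ > 0` such that for `0 < ρ < ρ₀`
there is `c > 0` with, for all large `N`, some `δ > 0` such that every periodic `δ`-near-minimiser `Ψ`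
of the `N`-body energy on the torus of side `(N/ρ)^{1/3}` has `condensateOccupation ≥ cN`.
NECESSARY for the crux (`periodicBEC_of_correctorClosure`, p121285: `CorrectorClosure ∧ K1` gives it for
every admissible `v`), so every line of this crux carries it; THIS line does not claim a device for it —
it is the slot the sibling lines `volume-homotopy-sum-rule-domination` (K1 ⇒ uniform structure factor +
sum-rule engine at `t = 1` along the volume path; hearts 12615′/12616′) and
`insertion-mode-gaussian-domination` (K1 + recoil ⇒ first-order hole-mode domination; heart (R) +
9094-weak) are planned to fill, or item 8997 itself (modus ponens through
`correctorClosure_of_periodicBEC`). Why plausibly true: Bogoliubov `n₀/N = 1 − (8/(3√π))√(ρa³)`;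
Fournais 2020 Thm 1.2 / Junge 2026 Cor. 6 on length scales `L ≲ a(ρa³)^{-3/4-η}`. Why it might fail to be
PROVABLE from K1: K1 is density-sector, BEC one-body-sector; in `d = 1` the K1-analogue excludes BEC
(Disproof §13). Size XL (open). Leans on: `StaticResponseBound` (hypothesis).
[cite: LSSY2005, Ch. 5 (5.1)–(5.2); Fournais2020, Thm 1.2] -/
theorem stub_periodicBEC (hK1 : StaticResponseBound) (v : ℝ → ℝ≥0∞) (hv : IsRepulsiveFiniteRange v)
    (hbdd : ∃ C : ℝ≥0, ∀ r, v r ≤ C) :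
    ∃ ρ₀ : ℝ, 0 < ρ₀ ∧ ∀ ρ : ℝ, 0 < ρ → ρ < ρ₀ → ∃ c : ℝ, 0 < c ∧ ∀ᶠ N : ℕ in atTop,
      ∃ δ : ℝ≥0∞, 0 < δ ∧ ∀ Ψ : PeriodicTrialState N (sideLength ρ N),
        periodicEnergy v Ψ ≤ periodicGroundStateEnergy v N (sideLength ρ N) + δ →
        ENNReal.ofReal (c * N) ≤ condensateOccupation N (sideLength ρ N) Ψ.ψ := by
  sorry

/-- **Stub — the unbounded (hard / singular core) case: the crux itself for unbounded admissible
potentials; typed VERBATIM as `HealingScaleKacInsertion.stub_unboundedCase` /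
`ResidueAreaLaw.stub_unboundedCase` (shared hole of every FK line; UNDELEGATED).** For an admissible `v`
that is NOT bounded the tree's torus Feynman–Kac theory has no input (bounded periodised potentials
only). What a proof would need: EITHER (i) the hard-core FK frame — connectivity / simple symmetric
ground state of the dilute free region (OPEN IN PRINT at fixed packing fraction, Disproof §16:
Baryshnikov–Bubenik–Kahle 2014 §6), `E₀^per < ⊤` eventually (`exists_eventually_periodicGroundStateEnergy_lt_top`),
and then the bounded chain verbatim IN ITS REMOVAL FORM (this line: the removal state is pair-dressed by
construction, Stub B has NO Born term, so both module stubs are typed identically for hard cores once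
`Θ₀, Φ₀` exist); OR (ii) truncation `v ∧ n ↑ v` with `(ρ₃, η)` uniform in `n`. Crux-sized by construction;
registered so that the composition is honest. Diluteness (Disproof §10) respected: `∃ ρ₀ > 0`.
Size XL (open). [cite: LSSY2005, Thm 2.5 (E₀ < ⊤ via Dyson's lemma)] -/
theorem stub_unboundedCase (hK1 : StaticResponseBound) (v : ℝ → ℝ≥0∞) (hv : IsRepulsiveFiniteRange v)
    (hub : ¬ ∃ C : ℝ≥0, ∀ r, v r ≤ C) :
    ∃ ρ₀ : ℝ, 0 < ρ₀ ∧ ∀ ρ : ℝ, 0 < ρ → ρ < ρ₀ → ∃ c : ℝ, 0 < c ∧ ∀ᶠ N : ℕ in Filter.atTop,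
      ∃ δ : ENNReal, 0 < δ ∧ ∃ Θ : PeriodicTrialState N (sideLength ρ (N + 1)),
        periodicEnergy v Θ ≤ periodicGroundStateEnergy v N (sideLength ρ (N + 1)) + δ ∧
        ∀ Ψ : PeriodicTrialState (N + 1) (sideLength ρ (N + 1)),
          periodicEnergy v Ψ ≤ periodicGroundStateEnergy v (N + 1) (sideLength ρ (N + 1)) + δ →
          ENNReal.ofReal c ≤ ENNReal.ofReal ((sideLength ρ (N + 1) ^ 3)⁻¹) *
            (‖∫ X in cellN N (sideLength ρ (N + 1)), conj (Θ.ψ X) *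
                ∫ x in cell (sideLength ρ (N + 1)), Ψ.ψ (vecCons x X)‖₊ : ℝ≥0∞) ^ 2 := by
  sorry

/-! ## Sorry-free glue: the two-moment sandwich in the `H₋₁` vocabulary -/

/-- **The removal Pythagoras identity.** For a cell-normalised continuous positive weight `Θ₀`
(`∫_cell Θ₀² = 1`) and a continuous `G`, the `Θ₀²`-mass of the centred ratio `g_c = G/Θ₀ − ⟨Θ₀,G⟩` is
`‖G_⊥‖² = ∫G² − ⟨Θ₀,G⟩²`. [folklore] -/
theorem integral_centredRatio_sq (L : ℝ) {N : ℕ} {Θ₀ G : Config N → ℝ} (hΘc : Continuous Θ₀)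
    (hΘp : ∀ X, 0 < Θ₀ X) (hGc : Continuous G) (m : ℝ) (hm : ∫ X in cellN N L, Θ₀ X * G X = m)
    (hone : ∫ X in cellN N L, Θ₀ X ^ 2 = 1) :
    ∫ X in cellN N L, (G X / Θ₀ X - m) * (G X / Θ₀ X - m) * Θ₀ X ^ 2 =
      (∫ X in cellN N L, G X ^ 2) - m ^ 2 := by
  have hpt : ∀ X, (G X / Θ₀ X - m) * (G X / Θ₀ X - m) * Θ₀ X ^ 2 =
      G X ^ 2 - 2 * m * (Θ₀ X * G X) + m ^ 2 * Θ₀ X ^ 2 := by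
    intro X
    have hne : Θ₀ X ≠ 0 := (hΘp X).ne'
    have h1 : (G X / Θ₀ X - m) * Θ₀ X = G X - m * Θ₀ X := by
      rw [sub_mul, div_mul_cancel₀ _ hne]
    calc (G X / Θ₀ X - m) * (G X / Θ₀ X - m) * Θ₀ X ^ 2
        = ((G X / Θ₀ X - m) * Θ₀ X) * ((G X / Θ₀ X - m) * Θ₀ X) := by ring
      _ = (G X - m * Θ₀ X) * (G X - m * Θ₀ X) := by rw [h1]
      _ = G X ^ 2 - 2 * m * (Θ₀ X * G X) + m ^ 2 * Θ₀ X ^ 2 := by ring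
  simp_rw [hpt]
  have h1 : Integrable (fun X => G X ^ 2) (volume.restrict (cellN N L)) :=
    integrableOn_cellN (hGc.pow 2) L
  have h2 : Integrable (fun X => 2 * m * (Θ₀ X * G X)) (volume.restrict (cellN N L)) :=
    (integrableOn_cellN (hΘc.mul hGc) L).const_mul (2 * m)
  have h3 : Integrable (fun X => m ^ 2 * Θ₀ X ^ 2) (volume.restrict (cellN N L)) :=
    (integrableOn_cellN (hΘc.pow 2) L).const_mul (m ^ 2)
  have h12 : Integrable (fun X => G X ^ 2 - 2 * m * (Θ₀ X * G X)) (volume.restrict (cellN N L)) :=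
    h1.sub h2
  rw [integral_add h12 h3, integral_sub h1 h2, integral_const_mul, integral_const_mul, hm, hone]
  ring

/-- **The removal-fidelity factor from the two moments (the card's `RemovalSandwich`, kernel-checked).**
Stub B (first moment `𝓔_{Θ₀}(g,g) ≤ μ∫G²`) and Stub R (`μ‖g_c‖²₋₁ ≤ η∫G²`, `η < 1` uniform in `N`)
give the `hFid` factor of `correctorClosure_of_factors` with `c₂ = 1 − √η`:
Kipnis–Varadhan's criterion (`sq_integral_sq_le_of_hMinusOneSqW_le`, Disproof §16) applied to the
centred ratio, `𝓔(g_c,g_c) = 𝓔(g,g)` (constants are `𝓔`-null), and the Pythagoras identity yield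
`(∫G² − ⟨Θ₀,G⟩²)² ≤ η (∫G²)²`, i.e. `(1 − √η)∫G² ≤ ⟨Θ₀,G⟩²`. K1 is not used. [folklore] -/
theorem removalFidelity_of_moments (v : ℝ → ℝ≥0∞) (hv : IsRepulsiveFiniteRange v)
    (hbdd : ∃ C : ℝ≥0, ∀ r, v r ≤ C) :
    ∃ ρ₃ : ℝ, 0 < ρ₃ ∧ ∀ ρ : ℝ, 0 < ρ → ρ < ρ₃ → ∃ c₂ : ℝ, 0 < c₂ ∧
      ∀ᶠ N : ℕ in atTop, ∀ (L : ℝ), L = sideLength ρ (N + 1) →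
        (∃ C : ℝ≥0, ∀ x, periodizedPotential v L x ≤ C) →
        ∀ (Θ₀ : Config N → ℝ), IsPeriodicGroundStateFK v L Θ₀ → Continuous Θ₀ → (∀ X, 0 < Θ₀ X) →
        ∀ (Φ₀ : Config (N + 1) → ℝ), IsPeriodicGroundStateFK v L Φ₀ → Continuous Φ₀ →
          (∀ X, 0 < Φ₀ X) →
        ∀ (G : Config N → ℝ), (G = fun X => ∫ x in cell L, Φ₀ (vecCons x X)) →
          ENNReal.ofReal c₂ * ∫⁻ X in cellN N L, ENNReal.ofReal (G X) ^ 2 ≤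
            ENNReal.ofReal ((∫ X in cellN N L, Θ₀ X * G X) ^ 2) := by
  obtain ⟨ρ₃, hρ₃, hR⟩ := stub_regularRemovalSusceptibility v hv hbdd
  refine ⟨ρ₃, hρ₃, fun ρ hρ hρlt => ?_⟩
  obtain ⟨η, hη0, hη1, hRη⟩ := hR ρ hρ hρlt
  have hsη : Real.sqrt η < 1 := by
    rw [← Real.sqrt_one]
    exact Real.sqrt_lt_sqrt hη0 hη1
  refine ⟨1 - Real.sqrt η, by linarith, ?_⟩
  filter_upwards [hRη] with N hRN L hL_def hb Θ₀ hΘ hΘc hΘp Φ₀ hΦ hΦc hΦp G hG_def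
  have hL : 0 < L := by
    rw [hL_def]
    exact sideLength_succ_pos hρ N
  -- Stub B: the ratio is a periodic test function and the first-moment budget
  obtain ⟨hg, hbudget⟩ := stub_removalEnergyBudget v hv N L hL hb Θ₀ hΘ hΘc hΘp Φ₀ hΦ hΦc hΦp G hG_def
  -- Stub R at this `N`
  obtain ⟨B, hB0, hH, hμB⟩ := hRN L hL_def hb Θ₀ hΘ hΘc hΘp Φ₀ hΦ hΦc hΦp G hG_def
  -- notation
  set μ : ℝ := (periodicGroundStateEnergy v (N + 1) L).toReal
      - (periodicGroundStateEnergy v N L).toReal with hμ_def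
  set m : ℝ := ∫ Y in cellN N L, Θ₀ Y * G Y with hm_def
  set S : ℝ := ∫ X in cellN N L, G X ^ 2 with hS_def
  set g : Config N → ℝ := fun X => G X / Θ₀ X with hg_def
  set gc : Config N → ℝ := fun X => G X / Θ₀ X - m with hgc_def
  -- positivity and continuity of the removal amplitude
  have hG0 : ∀ X, 0 ≤ G X := fun X => by
    rw [hG_def]
    exact setIntegral_nonneg (measurableSet_cell L) fun x _ => (hΦp _).le
  have hGc : Continuous G := by
    have h : Continuous fun X => g X * Θ₀ X := hg.continuous.mul hΘc
    have heq : (fun X => g X * Θ₀ X) = G := funext fun X => div_mul_cancel₀ (G X) (hΘp X).ne'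
    rwa [heq] at h
  have hS0 : 0 ≤ S := integral_nonneg fun X => sq_nonneg (G X)
  -- the centred ratio is a periodic test function with the same Dirichlet energy
  have hgc_eq : gc = g - fun _ => m := rfl
  have hgc : IsPeriodicTest L gc := by
    rw [hgc_eq]
    exact hg.sub (IsPeriodicTest.const L m)
  have hD : dirichletFormW L Θ₀ gc gc = dirichletFormW L Θ₀ g g := by
    rw [hgc_eq, dirichletFormW_sub_sub hΘc hg (IsPeriodicTest.const L m), dirichletFormW_const_right,
      dirichletFormW_const_left]
    ring
  -- Kipnis–Varadhan's criterion (the sandwich): `P² ≤ B · 𝓔(g_c, g_c)`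
  set P : ℝ := ∫ X in cellN N L, gc X * gc X * Θ₀ X ^ 2 with hP_def
  have hP0 : 0 ≤ P := integral_nonneg fun X => mul_nonneg (mul_self_nonneg _) (sq_nonneg _)
  have hKV : P ^ 2 ≤ B * dirichletFormW L Θ₀ gc gc := sq_integral_sq_le_of_hMinusOneSqW_le hgc hB0 hH
  -- combine with the two moment bounds: `P² ≤ η S²`
  have hP2 : P ^ 2 ≤ η * S ^ 2 := by
    calc P ^ 2 ≤ B * dirichletFormW L Θ₀ gc gc := hKV
      _ = B * dirichletFormW L Θ₀ g g := by rw [hD]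
      _ ≤ B * (μ * S) := mul_le_mul_of_nonneg_left hbudget hB0
      _ = (μ * B) * S := by ring
      _ ≤ (η * S) * S := mul_le_mul_of_nonneg_right hμB hS0
      _ = η * S ^ 2 := by ring
  have hPle : P ≤ Real.sqrt η * S := by
    have h1 : P ^ 2 ≤ (Real.sqrt η * S) ^ 2 := by
      rw [mul_pow, Real.sq_sqrt hη0]
      exact hP2
    calc P = Real.sqrt (P ^ 2) := (Real.sqrt_sq hP0).symm
      _ ≤ Real.sqrt ((Real.sqrt η * S) ^ 2) := Real.sqrt_le_sqrt h1
      _ = Real.sqrt η * S := Real.sqrt_sq (mul_nonneg (Real.sqrt_nonneg η) hS0)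
  -- Pythagoras: `P = S − m²`
  have hone : ∫ X in cellN N L, Θ₀ X ^ 2 = 1 := integral_sq_eq_one_of_fk hΘ hΘc hL
  have hPyth : P = S - m ^ 2 := integral_centredRatio_sq L hΘc hΘp hGc m hm_def.symm hone
  have h2 : S - m ^ 2 ≤ Real.sqrt η * S := by
    rw [← hPyth]
    exact hPle
  have hfloor : (1 - Real.sqrt η) * S ≤ m ^ 2 := by
    have h3 : (1 - Real.sqrt η) * S = S - Real.sqrt η * S := by ring
    rw [h3]
    linarith
  -- conversion to the `ℝ≥0∞` currency of the factor
  have hGi : Integrable (fun X => G X ^ 2) (volume.restrict (cellN N L)) :=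
    integrableOn_cellN (hGc.pow 2) L
  have hconv : ∫⁻ X in cellN N L, ENNReal.ofReal (G X) ^ 2 = ENNReal.ofReal S := by
    rw [hS_def, ofReal_integral_eq_lintegral_ofReal hGi (ae_of_all _ fun X => sq_nonneg (G X))]
    exact lintegral_congr fun X => (ENNReal.ofReal_pow (hG0 X) 2).symm
  rw [hconv, ← ENNReal.ofReal_mul (sub_nonneg.2 hsη.le)]
  exact ENNReal.ofReal_le_ofReal hfloor

/-! ## Composition (sorry-free): the registered stubs give the crux BY NAME -/

/-- **`CorrectorClosure` from the registered stubs** (kernel-checked glue, no `sorry` of its own):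
`correctorClosure_of_factors` (p122159) applied to the shared torus-BEC factor `stub_periodicBEC`, the
removal module `removalFidelity_of_moments` (Stubs B + R; K1 unused there), and the shared hard-core hole
`stub_unboundedCase`. Inside p122159: thresholds `min ρᵢ`, FK ground states eventually in `N`
(`stub_groundStateExists`), `f₀(Φ₀) ≥ c₁` from torus BEC at index `N+1` (`stub_occupationFloorFK_of_window`),
`A = f₀·F ≥ c₁(1−√η)`, and fixed-`N` rigidity (`stub_nearMinimiserRigidity`, `δ` after `N`). [folklore] -/
theorem CorrectorClosure_of : CorrectorClosure :=
  correctorClosure_of_factors stub_periodicBEC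
    (fun _ v hv hbdd => removalFidelity_of_moments v hv hbdd) stub_unboundedCase

end Summit.AtomisticToContinuum.BoseEinsteinCondensation.Cruxes.CorrectorClosure.ZeroModeRemovalSusceptibility

end
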